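import Literature.Analysis.FunctionSpaces.TorusClassicalNSGluing
import Literature.Analysis.FunctionSpaces.TorusHeatSmoothing
import Literature.Analysis.FunctionSpaces.TorusHeatKernel
import HarnessLib

/-!
# Classical Navier–Stokes solutions on the flat torus: locality in time, gluing on a finite
# window, and the sup-norm decay of the heat flow of mean-zero data

Function-space support file (all results proved; no definitions, no named facts) for the
continuation argument behind `Literature.Barriers.NavierStokesRegularity.CoiculescuPalasek2025_globalExtension`
(Coiculescu–Palasek 2025, §5, last paragraph: a smooth solution on `𝕋³` that is small at time `T`
is continued for all times by restarting the local theory; Robinson–Rodrigo–Sadowski 2016, §8.1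
and Lemma 6.11: restart at a later time, identify on the overlap, iterate). It continues
`TorusClassicalNSGluing` (restriction, mean conservation, pressure normalisation, `glue_Ioi`):

* `Torus.IsClassicalNSSolutionOn.of_local` — **being a classical solution is local in time**:
  on an open time set `S`, a pair `(u, p)` which near every `t ∈ S` agrees with some classical
  solution on an open neighbourhood is a classical solution on `S` (joint smoothness is local,
  Mathlib `contDiffOn_of_locally_contDiffOn`; two-sided time derivatives of fields agreeing near
  `t` coincide);
* `Torus.IsClassicalNSSolutionOn.sub_pressure_apply` — normalising the pressure by its value at a
  base point keeps a classical solution;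
* `Torus.IsClassicalNSSolutionOn.glue_Ioo` — gluing a solution on `(c, T)` with one on `(a, b)`,
  `c ≤ a < T ≤ b`, agreeing on `(a, T)`, to a solution on `(c, b)` (finite-window twin of
  `glue_Ioi`, now a corollary of locality);
* `Torus.norm_heatSmoothing_le_of_hasZeroMean` — **sup-norm decay of the heat flow of mean-zero
  data**: for a smooth mean-zero field `v` with `‖v‖ ≤ A`,
  `‖∫ G_s(z) v(x − proj z) dz‖ ≤ (∑ₖ e^{-4π²|k|²s} − 1) A` (the Fourier series of the heat
  smoothing, `Torus.hasSum_heatSmoothing`, has no zero mode, and `|v̂(k)| ≤ ‖v‖_{L¹} ≤ A`), and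
  `Torus.exists_tsum_heatCoeff_sub_one_le` — the factor `∑ₖ e^{-4π²|k|²τ} − 1` is as small as we
  please for `τ` large (`Torus.tsum_heatCoeff_sub_one_le`).

## Mathlib / tree search

Tree: `Torus.IsClassicalNSSolutionOn.pressure_sub_eq_of_eventuallyEq`, `….glue_Ioi`,
`Torus.IsSmoothSpaceTimeOn.sub_slice_apply_const`, `Torus.gradient_sub_const_apply`
(`TorusClassicalNSGluing`); `Torus.hasSum_heatSmoothing`, `Torus.norm_realPart_mFourier_smul_le`,
`Torus.summable_norm_mFourierCoeff_of_isSmooth`, `Torus.mFourierCoeff_eq_integral_volume`,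
`Torus.heatCoeff`, `Torus.summable_heatCoeff`, `Torus.tsum_heatCoeff_sub_one_le`,
`Torus.one_le_tsum_heatCoeff`. Mathlib: `contDiffOn_of_locally_contDiffOn`,
`derivWithin_of_mem_nhds`, `Filter.EventuallyEq.deriv_eq`, `Summable.tsum_eq_add_tsum_ite`,
`norm_tsum_le_tsum_norm`, `UnitAddTorus.mFourier_zero`, `LinearIsometry.integral_comp_comm`.

## References

* J. C. Robinson, J. L. Rodrigo, W. Sadowski, *The Three-Dimensional Navier–Stokes Equations.
  Classical Theory*, CUP 2016, §6.3 (Lemma 6.11), §8.1. [RobinsonRodrigoSadowskiCUP2016]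
* M. P. Coiculescu, S. Palasek, Invent. Math. 244 (2025) = arXiv:2503.14699, §5, last paragraph.
  [CoiculescuPalasek2025]
* L. Grafakos, *Classical Fourier Analysis*, 3rd ed. (2014), §3.1 (Fourier series on `𝕋ⁿ`).
  [Grafakos2014]
-/

open MeasureTheory Set Filter UnitAddTorus
open _root_.Topology
open scoped InnerProductSpace ContDiff

noncomputable section

namespace Literature.Analysis.FunctionSpaces

namespace Torus

variable {d : Type*} [Fintype d] [DecidableEq d]

/-! ## Locality in time -/

section Local

variable {ν : ℝ} {f : ℝ → UnitAddTorus d → EuclideanSpace ℝ d}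

/-- **Classical solutions are local in time.** Let `S` be an open time set and `(u, p)` a pair
of fields such that every `t ∈ S` has an open neighbourhood `O ⊆ S` carrying a classical
solution `(u', p')` (same viscosity and force) with `u' = u`, `p' = p` on `O`. Then `(u, p)` is
a classical solution on `S`: joint smoothness is a local property, and at `t ∈ O` the time
derivative within the open `S` is the two-sided derivative, which only sees the field near `t`.
[folklore] -/
theorem IsClassicalNSSolutionOn.of_local {S : Set ℝ} (hS : IsOpen S)
    {u : ℝ → UnitAddTorus d → EuclideanSpace ℝ d} {p : ℝ → UnitAddTorus d → ℝ}
    (h : ∀ t ∈ S, ∃ O : Set ℝ, IsOpen O ∧ t ∈ O ∧ O ⊆ S ∧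
      ∃ (u' : ℝ → UnitAddTorus d → EuclideanSpace ℝ d) (p' : ℝ → UnitAddTorus d → ℝ),
        IsClassicalNSSolutionOn O ν f u' p' ∧ (∀ s ∈ O, u' s = u s) ∧ (∀ s ∈ O, p' s = p s)) :
    IsClassicalNSSolutionOn S ν f u p := by
  have hset : ∀ {O : Set ℝ}, O ⊆ S →
      (S ×ˢ (univ : Set (EuclideanSpace ℝ d))) ∩ O ×ˢ univ = O ×ˢ univ := fun hOS => by
    rw [prod_inter_prod, inter_eq_right.2 hOS, inter_self]
  refine ⟨?_, ?_, fun t ht x => ?_, fun t ht => ?_⟩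
  · refine contDiffOn_of_locally_contDiffOn fun z hz => ?_
    obtain ⟨t, y⟩ := z
    obtain ⟨O, hO, htO, hOS, u', p', h', hu', -⟩ := h t (mem_prod.1 hz).1
    refine ⟨O ×ˢ univ, hO.prod isOpen_univ, ⟨htO, mem_univ _⟩, ?_⟩
    rw [hset hOS]
    exact h'.smooth_velocity.congr fun z hz => by
      obtain ⟨τ, y'⟩ := z
      simp only [stLift_apply, hu' τ (mem_prod.1 hz).1]
  · refine contDiffOn_of_locally_contDiffOn fun z hz => ?_
    obtain ⟨t, y⟩ := z
    obtain ⟨O, hO, htO, hOS, u', p', h', -, hp'⟩ := h t (mem_prod.1 hz).1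
    refine ⟨O ×ˢ univ, hO.prod isOpen_univ, ⟨htO, mem_univ _⟩, ?_⟩
    rw [hset hOS]
    exact h'.smooth_pressure.congr fun z hz => by
      obtain ⟨τ, y'⟩ := z
      simp only [stLift_apply, hp' τ (mem_prod.1 hz).1]
  · obtain ⟨O, hO, htO, -, u', p', h', hu', hp'⟩ := h t ht
    have hev : (fun τ => u τ x) =ᶠ[𝓝 t] fun τ => u' τ x := by
      filter_upwards [hO.mem_nhds htO] with τ hτ
      rw [hu' τ hτ]
    have hD : timeDerivWithin S u t x = timeDerivWithin O u' t x := by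
      simp only [timeDerivWithin]
      rw [derivWithin_of_mem_nhds (hS.mem_nhds ht), derivWithin_of_mem_nhds (hO.mem_nhds htO)]
      exact hev.deriv_eq
    rw [hD, ← hu' t htO, ← hp' t htO]
    exact h'.momentum t htO x
  · obtain ⟨O, -, htO, -, u', p', h', hu', -⟩ := h t ht
    rw [← hu' t htO]
    exact h'.divFree t htO

/-- **Pressure normalisation**: subtracting from the pressure its value at a base point `x₀`
(a function of time alone) keeps a classical solution. [folklore] -/
theorem IsClassicalNSSolutionOn.sub_pressure_apply {S : Set ℝ}
    {u : ℝ → UnitAddTorus d → EuclideanSpace ℝ d} {p : ℝ → UnitAddTorus d → ℝ}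
    (h : IsClassicalNSSolutionOn S ν f u p) (x₀ : UnitAddTorus d) :
    IsClassicalNSSolutionOn S ν f u (fun t x => p t x - p t x₀) where
  smooth_velocity := h.smooth_velocity
  smooth_pressure := h.smooth_pressure.sub_slice_apply_const x₀
  momentum t ht x := by
    rw [gradient_sub_const_apply]
    exact h.momentum t ht x
  divFree := h.divFree

/-- **Gluing classical solutions on the torus along an open overlap, finite window.** Let
`(u₁, p₁)` be a classical solution on `(c, T)` and `(u₂, p₂)` one on `(a, b)` (same viscosity
and force), `c ≤ a < T ≤ b`, with `u₁(t) = u₂(t)` for `t ∈ (a, T)`. Then the velocity equal to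
`u₁` for `t < T` and to `u₂` for `t ≥ T`, with the pressures normalised at the base point `x₀`,
is a classical solution on `(c, b)` (by locality: near `t < T` it is `(u₁, p₁ − p₁(·, x₀))`, near
`t ≥ T` it is `(u₂, p₂ − p₂(·, x₀))`, the normalised pressures agreeing on the overlap by
`pressure_sub_eq_of_eventuallyEq`). This is the restart-and-identify step of every continuation
argument (Robinson–Rodrigo–Sadowski 2016, §8.1). [folklore] -/
theorem IsClassicalNSSolutionOn.glue_Ioo {c a T b : ℝ}
    {u₁ u₂ : ℝ → UnitAddTorus d → EuclideanSpace ℝ d} {p₁ p₂ : ℝ → UnitAddTorus d → ℝ}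
    (h₁ : IsClassicalNSSolutionOn (Ioo c T) ν f u₁ p₁) (h₂ : IsClassicalNSSolutionOn (Ioo a b) ν f u₂ p₂)
    (hca : c ≤ a) (haT : a < T) (hTb : T ≤ b) (heq : ∀ t ∈ Ioo a T, u₁ t = u₂ t)
    (x₀ : UnitAddTorus d) :
    IsClassicalNSSolutionOn (Ioo c b) ν f (fun t => if t < T then u₁ t else u₂ t)
      (fun t => if t < T then (fun x => p₁ t x - p₁ t x₀) else fun x => p₂ t x - p₂ t x₀) := by
  have hpr : ∀ t ∈ Ioo a T, ∀ x, p₁ t x - p₁ t x₀ = p₂ t x - p₂ t x₀ := fun t ht x =>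
    h₁.pressure_sub_eq_of_eventuallyEq h₂ (Ioo_mem_nhds (hca.trans_lt ht.1) ht.2)
      (Ioo_mem_nhds ht.1 (ht.2.trans_le hTb))
      (by filter_upwards [Ioo_mem_nhds ht.1 ht.2] with τ hτ using heq τ hτ) x x₀
  refine IsClassicalNSSolutionOn.of_local isOpen_Ioo fun t ht => ?_
  by_cases htT : t < T
  · refine ⟨Ioo c T, isOpen_Ioo, ⟨ht.1, htT⟩, Ioo_subset_Ioo_right hTb, u₁,
      fun t x => p₁ t x - p₁ t x₀, h₁.sub_pressure_apply x₀, fun s hs => ?_, fun s hs => ?_⟩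
    · simp only [if_pos hs.2]
    · simp only [if_pos hs.2]
  · have hTt : T ≤ t := not_lt.1 htT
    refine ⟨Ioo a b, isOpen_Ioo, ⟨haT.trans_le hTt, ht.2⟩, Ioo_subset_Ioo_left hca, u₂,
      fun t x => p₂ t x - p₂ t x₀, h₂.sub_pressure_apply x₀, fun s hs => ?_, fun s hs => ?_⟩
    · by_cases hsT : s < T
      · simp only [if_pos hsT]
        exact (heq s ⟨hs.1, hsT⟩).symm
      · simp only [if_neg hsT]
    · by_cases hsT : s < T
      · simp only [if_pos hsT]
        funext x
        exact (hpr s ⟨hs.1, hsT⟩ x).symm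
      · simp only [if_neg hsT]

end Local

/-! ## Sup-norm decay of the heat flow of mean-zero data -/

section HeatDecay

/-- **The heat flow of mean-zero data decays in sup norm.** For a smooth real vector field `v` on
`𝕋ᵈ` with `∫ v = 0` and `‖v(x)‖ ≤ A`, and `s > 0`,
`‖∫ G_s(z) v(x − proj z) dz‖ ≤ (∑ₖ e^{-4π²|k|²s} − 1) A` for every `x`: by
`Torus.hasSum_heatSmoothing` the heat smoothing is `∑ₖ Re(e^{-4π²s|k|²} e_k(x) v̂(k))`; the zero
mode is `v̂(0) = ∫ v = 0`, and `‖v̂(k)‖ ≤ ‖v‖_{L¹} ≤ A` for the others (Grafakos 2014, §3.1: the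
Fourier coefficients of an `L¹` function are bounded by its `L¹` norm). [folklore] -/
theorem norm_heatSmoothing_le_of_hasZeroMean {v : UnitAddTorus d → EuclideanSpace ℝ d}
    (hv : IsSmooth v) (h0 : HasZeroMean v) {A : ℝ} (hA : ∀ x, ‖v x‖ ≤ A) {s : ℝ} (hs : 0 < s)
    (x : UnitAddTorus d) :
    ‖∫ z : EuclideanSpace ℝ d, UnboundedOperators.heatKernel s z • v (x - proj z)‖ ≤
      ((∑' k : d → ℤ, heatCoeff s k) - 1) * A := by
  set c : (d → ℤ) → EuclideanSpace ℂ d := mFourierCoeff (EuclideanSpace.complexify ∘ v) with hc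
  have hA0 : 0 ≤ A := (norm_nonneg _).trans (hA 0)
  have h := hasSum_heatSmoothing hv hs x
  -- the coefficients: bounded by `A`, and no zero mode
  have hck : ∀ k, ‖c k‖ ≤ A := by
    intro k
    rw [hc, mFourierCoeff_eq_integral_volume]
    calc ‖∫ y, mFourier (-k) y • (EuclideanSpace.complexify ∘ v) y‖
        ≤ ∫ y, ‖mFourier (-k) y • (EuclideanSpace.complexify ∘ v) y‖ :=
          norm_integral_le_integral_norm _
      _ ≤ ∫ _y : UnitAddTorus d, A := by
          refine integral_mono_of_nonneg (ae_of_all _ fun y => norm_nonneg _) (integrable_const A)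
            (ae_of_all _ fun y => ?_)
          show ‖mFourier (-k) y • (EuclideanSpace.complexify ∘ v) y‖ ≤ A
          rw [norm_smul, Function.comp_apply, EuclideanSpace.norm_complexify]
          calc ‖mFourier (-k) y‖ * ‖v y‖ ≤ 1 * A :=
                mul_le_mul (((mFourier (-k)).norm_coe_le_norm y).trans_eq mFourier_norm) (hA y)
                  (norm_nonneg _) zero_le_one
            _ = A := one_mul A
      _ = A := by simp
  have hc0 : c 0 = 0 := by
    rw [hc, mFourierCoeff_eq_integral_volume]
    simp only [neg_zero, mFourier_zero, ContinuousMap.one_apply, one_smul, Function.comp_apply]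
    have hL := (EuclideanSpace.complexify : EuclideanSpace ℝ d →ₗᵢ[ℝ] EuclideanSpace ℂ d)
      |>.toContinuousLinearMap.integral_comp_comm hv.integrable
    simp only [LinearIsometry.coe_toContinuousLinearMap] at hL
    have h0' : ∫ y, v y = 0 := h0
    rw [hL, h0', map_zero]
  -- termwise bounds
  have hterm : ∀ k : d → ℤ, ‖EuclideanSpace.realPart
      (Real.exp (-(s * (4 * Real.pi ^ 2 * freqNormSq k))) • (mFourier k x • c k))‖ ≤
        if k = 0 then 0 else heatCoeff s k * A := by
    intro k
    by_cases hk : k = 0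
    · subst hk
      simp [hc0]
    · rw [if_neg hk, map_smul, norm_smul, Real.norm_of_nonneg (Real.exp_nonneg _), heatCoeff_apply,
        mul_comm (4 * Real.pi ^ 2 * freqNormSq k) s]
      exact mul_le_mul_of_nonneg_left ((norm_realPart_mFourier_smul_le k x _).trans (hck k))
        (Real.exp_nonneg _)
  have hmaj : Summable fun k : d → ℤ => if k = 0 then (0 : ℝ) else heatCoeff s k * A := by
    refine Summable.of_nonneg_of_le (fun k => ?_) (fun k => ?_) ((summable_heatCoeff hs).mul_right A)
    · split_ifs
      · exact le_rfl
      · exact mul_nonneg (heatCoeff_pos s k).le hA0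
    · split_ifs
      · exact mul_nonneg (heatCoeff_pos s k).le hA0
      · exact le_rfl
  have hnsum : Summable fun k : d → ℤ => ‖EuclideanSpace.realPart
      (Real.exp (-(s * (4 * Real.pi ^ 2 * freqNormSq k))) • (mFourier k x • c k))‖ :=
    Summable.of_nonneg_of_le (fun k => norm_nonneg _) hterm hmaj
  rw [← h.tsum_eq]
  calc ‖∑' k : d → ℤ, EuclideanSpace.realPart
          (Real.exp (-(s * (4 * Real.pi ^ 2 * freqNormSq k))) • (mFourier k x • c k))‖
      ≤ ∑' k : d → ℤ, ‖EuclideanSpace.realPart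
          (Real.exp (-(s * (4 * Real.pi ^ 2 * freqNormSq k))) • (mFourier k x • c k))‖ :=
        norm_tsum_le_tsum_norm hnsum
    _ ≤ ∑' k : d → ℤ, (if k = 0 then 0 else heatCoeff s k * A) := hnsum.tsum_le_tsum hterm hmaj
    _ = (∑' k : d → ℤ, (if k = 0 then 0 else heatCoeff s k)) * A := by
        rw [← tsum_mul_right]
        refine tsum_congr fun k => ?_
        split_ifs <;> simp
    _ = ((∑' k : d → ℤ, heatCoeff s k) - 1) * A := by
        rw [(summable_heatCoeff hs).tsum_eq_add_tsum_ite 0, heatCoeff_zero_right]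
        ring

omit [DecidableEq d] in
/-- The decay factor `∑ₖ e^{-4π²|k|²τ} − 1` is as small as we please for `τ` large (it is at most
`e^{-4π²(τ−1)} (∑ₖ e^{-4π²|k|²} − 1)` for `τ ≥ 1`, `Torus.tsum_heatCoeff_sub_one_le`). [folklore] -/
theorem exists_tsum_heatCoeff_sub_one_le {δ : ℝ} (hδ : 0 < δ) :
    ∃ τ : ℝ, 1 ≤ τ ∧ (∑' k : d → ℤ, heatCoeff τ k) - 1 ≤ δ := by
  classical
  set C₁ : ℝ := (∑' k : d → ℤ, heatCoeff 1 k) - 1 with hC₁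
  have hlim : Tendsto (fun τ : ℝ => Real.exp (-(4 * Real.pi ^ 2 * (τ - 1))) * C₁) atTop (𝓝 0) := by
    have h1 : Tendsto (fun τ : ℝ => -(4 * Real.pi ^ 2 * (τ - 1))) atTop atBot := by
      have h2 : Tendsto (fun τ : ℝ => 4 * Real.pi ^ 2 * (τ - 1)) atTop atTop :=
        (tendsto_atTop_add_const_right _ (-1) tendsto_id).const_mul_atTop (by positivity)
      exact tendsto_neg_atTop_atBot.comp h2
    simpa using (Real.tendsto_exp_atBot.comp h1).mul_const C₁
  obtain ⟨N, hN⟩ := eventually_atTop.1 (hlim.eventually (Iic_mem_nhds hδ))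
  refine ⟨max N 1, le_max_right _ _, ?_⟩
  exact (tsum_heatCoeff_sub_one_le (le_max_right _ _)).trans (hN _ (le_max_left _ _))

end HeatDecay

end Torus

end Literature.Analysis.FunctionSpaces
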